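import Mathlib
import HarnessLib

/-!
# QUANT lane R8, front "FAR beyond trees", layer one — THE DEGREE-THREE GATE AT THE OBSERVER, LXIX-0: pinch blow-up charts — COMMON lemma
# (`Gate3.chartC_Bpos`: at a bad point of the chart-C system both `B`-cells are positive)

builds on p205010 (kernel theorem, internal audit signed; external expert review pending)

Support file (`--supports stmt-CriticalPhenomena-4575`), seat `prim-quant-p1` (gen 35); memo
`run/shared/lean/prim/quant/prim-quant-p1-g35/FOR-LEAD-GATE3-PINCH.md`.  Mathlib only; standard axioms; no sorries.

In the chart-C system (file XLVI) the only positive coefficient of the form `g₁/u` is the one of `B1` and the only positive coefficient of `g₂/u` is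
the one of `B2` (for `0 ≤ σ`, `0 ≤ u`, `σu ≤ 1`, `0 ≤ r₁ ≤ r₂ ≤ 1`); hence `g₁/u > 0` forces `B1 > 0` and `g₂/u > 0` forces `B2 > 0`.  This is the
strictness input `0 < v 3 ∧ 0 < v 4` of `CertN.Bad` for every pinch chart (link files LXXI-W/R/U/P/M).
[this work].
-/

namespace Summit.CriticalPhenomena.PercolationContinuityZ3.Theorems

namespace Quant

namespace Gate3

/-- At a bad point of the chart-C system, `B1 > 0` and `B2 > 0`. [this work] -/
theorem chartC_Bpos (σ u r₁ r₂ : ℝ) (hσ0 : 0 ≤ σ) (hu0 : 0 ≤ u) (hσu : σ * u ≤ 1) (hr10 : 0 ≤ r₁) (hr12 : r₁ ≤ r₂) (hr21 : r₂ ≤ 1)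
    (a0 a1 A2 B1 B2 c1 : ℝ) (ha0 : 0 ≤ a0) (ha1 : 0 ≤ a1) (hA2 : 0 ≤ A2) (hB1 : 0 ≤ B1) (hB2 : 0 ≤ B2) (hc1 : 0 ≤ c1)
    (hG1 : 0 < (1 - σ * u) * (1 - r₁) * B1 - σ * (r₂ * (1 - r₁)) * a0 - σ * (1 - r₁) * a1 - σ * (1 - σ * u * r₁) * A2 -
      (1 - (1 - σ * u) * (1 - r₂)) * (1 - r₁) * B2 - σ * ((1 - r₁) * (1 - r₂)) * c1)
    (hG2 : 0 < (1 - σ * u) * (1 - r₂) * B2 - σ * (r₁ * (1 - r₂)) * a0 - σ * (1 - r₂) * a1 - σ * (1 - σ * u * r₂) * A2 -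
      (1 - (1 - σ * u) * (1 - r₁)) * (1 - r₂) * B1 - σ * ((1 - r₁) * (1 - r₂)) * c1) :
    0 < B1 ∧ 0 < B2 := by
  have hsu : 0 ≤ σ * u := mul_nonneg hσ0 hu0
  have hr20 : 0 ≤ r₂ := le_trans hr10 hr12
  have hr11 : r₁ ≤ 1 := le_trans hr12 hr21
  have w1 : 0 ≤ 1 - r₁ := by linarith
  have w2 : 0 ≤ 1 - r₂ := by linarith
  have hq : 0 ≤ 1 - σ * u := by linarith
  have hq1 : 1 - σ * u ≤ 1 := by linarith
  have e1 : 0 ≤ 1 - σ * u * r₁ := by nlinarith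
  have e2 : 0 ≤ 1 - σ * u * r₂ := by nlinarith
  have f1 : 0 ≤ 1 - (1 - σ * u) * (1 - r₂) := by nlinarith [mul_le_one₀ hq1 w2 (by linarith : 1 - r₂ ≤ 1)]
  have f2 : 0 ≤ 1 - (1 - σ * u) * (1 - r₁) := by nlinarith [mul_le_one₀ hq1 w1 (by linarith : 1 - r₁ ≤ 1)]
  have t1 : 0 ≤ σ * (r₂ * (1 - r₁)) * a0 := by positivity
  have t2 : 0 ≤ σ * (1 - r₁) * a1 := by positivity
  have t3 : 0 ≤ σ * (1 - σ * u * r₁) * A2 := by positivity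
  have t4 : 0 ≤ (1 - (1 - σ * u) * (1 - r₂)) * (1 - r₁) * B2 := by positivity
  have t5 : 0 ≤ σ * ((1 - r₁) * (1 - r₂)) * c1 := by positivity
  have s1 : 0 ≤ σ * (r₁ * (1 - r₂)) * a0 := by positivity
  have s2 : 0 ≤ σ * (1 - r₂) * a1 := by positivity
  have s3 : 0 ≤ σ * (1 - σ * u * r₂) * A2 := by positivity
  have s4 : 0 ≤ (1 - (1 - σ * u) * (1 - r₁)) * (1 - r₂) * B1 := by positivity
  constructor
  · by_contra h
    have hB10 : B1 = 0 := le_antisymm (not_lt.1 h) hB1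
    rw [hB10, mul_zero] at hG1
    linarith
  · by_contra h
    have hB20 : B2 = 0 := le_antisymm (not_lt.1 h) hB2
    rw [hB20, mul_zero] at hG2
    linarith

end Gate3

end Quant

end Summit.CriticalPhenomena.PercolationContinuityZ3.Theorems
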